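import Mathlib.GroupTheory.FreeGroup.Reduce
import Mathlib.Data.Fintype.Perm
import Mathlib.GroupTheory.Perm.Fin
import Literature.Topology.FourManifolds.SurfaceGroupAmalgam
import HarnessLib

/-!
# Slot symmetry of the standard trisection of `S⁴` at every genus

Topic `Literature/Topology/FourManifolds`; everything here is PROVED (no named facts, no `Prop`
definitions).  Written by the refuter seat of crux `WaldhausenPairs` (route
`SmoothPoincare4/CongruenceShadows`) as reusable structure for every item that quantifies over
the three slots of `s4Kernels.stabilizeIter m` (the kernel triple `N` of the standard
`(3+3m; m+1)` trisection of `S⁴`, Abrams–Gay–Kirby 2018 §2, Gay–Kirby 2016 §1).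

* `RelatorAut g` — free-level data of an automorphism of the surface group `S_g`: an automorphism
  of `F⟨a₁,…,b_g⟩` with its inverse, both fixing the surface relator `∏[aᵢ,bᵢ]` ON THE NOSE;
  `toMulEquiv : S_g ≃* S_g`; `refl`, `trans`; and the BLOCK SUM `blockSum : RelatorAut g →
  RelatorAut h → RelatorAut (g+h)` (`r_{g+h} = ι r_g · σ r_h`, `SurfaceGroupAmalgam.lean`), with its
  action on stabilisations `map_blockSum_stabilize` (slot by slot on `K.stabilize`).
* genus 3: the relator-fixing cyclic handle shift `cyc` (`x_h ↦ [a₀,b₀] x_{h+1} [a₀,b₀]⁻¹`) and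
  the relator-fixing adjacent handle transposition `swp` (`a₁ ↦ [a₁,b₁]a₂[a₁,b₁]⁻¹`,
  `b₁ ↦ [a₁,b₁]b₂[a₁,b₁]⁻¹`, `a₂ ↦ a₁`, `b₂ ↦ b₁`; the naive letter swap does not fix the relator),
  all identities checked by `decide` in the free group; their slot actions on
  `s4Kernels = (⟪a₀,a₁,b₂⟫, ⟪a₀,b₁,a₂⟫, ⟪b₀,a₁,a₂⟫)`: `cyc` is the 3-cycle `N₀ ↦ N₂ ↦ N₁ ↦ N₀`,
  `swp` the transposition `N₀ ↔ N₁` fixing `N₂`.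
* `stabilizeIter_slotSymmetric` — for every `m` and every `π ∈ Sym(Fin 3)` there is
  `σ ∈ Aut S_{3+3m}` with `σ(N_i) = N_{π i}` for all `i` (induction over block sums); corollaries
  `exists_swap_stabilizeIter` (ordered = unordered standard pairs) and
  `exists_aut_pair_stabilizeIter` (all ordered standard pairs are `Aut`-equivalent to `(N₀,N₁)`);
  `IsGroupTrisection.comp_perm` — the trisection property is invariant under permuting slots.

Design / siblings.  A `RelatorAut` is the special case `ε = 1`, `c = 1` of the "liftable
automorphism" hypothesis of `TrisectionKernels.iso_stabilize_map_of_lift`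
(`TrisectionFunctorGKStabilization.lean`: `φ r_g = c · r_g^ε · c⁻¹`), packaged as DATA (hom and
inverse as free-group endomorphisms) so that two of them can be juxtaposed on the two sides of
`S_{g+h} = F_{2g} ∗_ℤ F_{2h}` (`freeExtend`, `surfaceRelator_add` of `SurfaceGroupAmalgam.lean`):
fixing the relator on the nose on BOTH sides is what makes the juxtaposition respect `r_{g+h}`.
The sibling theorem `iso_stabilize_map_of_lift` moves the first `g` handles and keeps (or flips)
the three new ones slot by slot; here the new handles must be permuted among the slots as well,
which is why a genus-3 realiser `B` rides in the second block.

Not here: anything about non-standard triples; Nielsen's theorem (every automorphism of `S_g`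
lifts); the topological meaning (these automorphisms are induced by diffeomorphisms of `Σ_g`
permuting the three handlebodies of the standard trisection, Gay–Kirby 2016 §2 — only the algebra
is formalised).

## References

* D. Gay, R. Kirby, *Trisecting 4-manifolds*, Geom. Topol. 20 (2016) 3097–3132, §1–2 (the
  genus-3 trisection of `S⁴` and its stabilisations). [GayKirby2016]
* A. Abrams, D. Gay, R. Kirby, *Group trisections and smooth 4-manifolds*, Geom. Topol. 22
  (2018) 1537–1545, Def. 2–3 (connected sum, stabilisation). [AbramsGayKirby2018]
* J. Nielsen, *Untersuchungen zur Topologie der geschlossenen zweiseitigen Flächen*, Acta Math. 50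
  (1927) (automorphisms of `S_g` from automorphisms of `F_{2g}` fixing the relator). [Nielsen1927]
-/

noncomputable section

open Set Subgroup

namespace Literature.Topology.FourManifolds

variable {g h : ℕ}

/-- Free-level data of an automorphism of `S_g` compatible with connected sums: an automorphism
of `F⟨a₁,…,b_g⟩` (with its inverse) fixing the surface relator ON THE NOSE. [folklore] -/
structure RelatorAut (g : ℕ) where
  /-- the free-group endomorphism -/
  hom : FreeGroup (surfaceGen g) →* FreeGroup (surfaceGen g)
  /-- its inverse -/
  inv : FreeGroup (surfaceGen g) →* FreeGroup (surfaceGen g)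
  hom_rel : hom (surfaceRelator g) = surfaceRelator g
  inv_rel : inv (surfaceRelator g) = surfaceRelator g
  inv_comp : inv.comp hom = MonoidHom.id _
  hom_comp : hom.comp inv = MonoidHom.id _

namespace RelatorAut

/-- A relator-fixing endomorphism kills the relator in `S_g`. [folklore] -/
theorem mk_comp_rel (φ : FreeGroup (surfaceGen g) →* FreeGroup (surfaceGen g))
    (hφ : φ (surfaceRelator g) = surfaceRelator g) :
    ∀ r ∈ ({surfaceRelator g} : Set (FreeGroup (surfaceGen g))),
      ((PresentedGroup.mk ({surfaceRelator g} : Set (FreeGroup (surfaceGen g)))).comp φ) r = 1 := by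
  intro r hr
  rw [Set.mem_singleton_iff] at hr
  subst hr
  rw [MonoidHom.comp_apply, hφ]
  exact PresentedGroup.one_of_mem (Set.mem_singleton _)

/-- The induced endomorphism of `S_g`. [folklore] -/
def toHom (A : RelatorAut g) : SurfaceGroup g →* SurfaceGroup g :=
  presentedLift ((PresentedGroup.mk _).comp A.hom) (mk_comp_rel A.hom A.hom_rel)

/-- The induced inverse endomorphism of `S_g`. [folklore] -/
def invHom (A : RelatorAut g) : SurfaceGroup g →* SurfaceGroup g :=
  presentedLift ((PresentedGroup.mk _).comp A.inv) (mk_comp_rel A.inv A.inv_rel)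

/-- `toHom` on the class of a word. [folklore] -/
@[simp] theorem toHom_mk (A : RelatorAut g) (w : FreeGroup (surfaceGen g)) :
    A.toHom (PresentedGroup.mk _ w) = PresentedGroup.mk _ (A.hom w) := by
  simp [toHom]

/-- `invHom` on the class of a word. [folklore] -/
@[simp] theorem invHom_mk (A : RelatorAut g) (w : FreeGroup (surfaceGen g)) :
    A.invHom (PresentedGroup.mk _ w) = PresentedGroup.mk _ (A.inv w) := by
  simp [invHom]

/-- `invHom ∘ toHom = id`. [folklore] -/
theorem invHom_comp_toHom (A : RelatorAut g) : A.invHom.comp A.toHom = MonoidHom.id _ :=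
  MonoidHom.ext fun x => by
    obtain ⟨w, rfl⟩ := PresentedGroup.mk_surjective _ x
    rw [MonoidHom.comp_apply, toHom_mk, invHom_mk, ← MonoidHom.comp_apply A.inv, A.inv_comp]
    rfl

/-- `toHom ∘ invHom = id`. [folklore] -/
theorem toHom_comp_invHom (A : RelatorAut g) : A.toHom.comp A.invHom = MonoidHom.id _ :=
  MonoidHom.ext fun x => by
    obtain ⟨w, rfl⟩ := PresentedGroup.mk_surjective _ x
    rw [MonoidHom.comp_apply, invHom_mk, toHom_mk, ← MonoidHom.comp_apply A.hom, A.hom_comp]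
    rfl

/-- The induced automorphism of `S_g`. [folklore] -/
def toMulEquiv (A : RelatorAut g) : SurfaceGroup g ≃* SurfaceGroup g :=
  MonoidHom.toMulEquiv A.toHom A.invHom A.invHom_comp_toHom A.toHom_comp_invHom

/-- `toMulEquiv` on the class of a word. [folklore] -/
@[simp] theorem toMulEquiv_mk (A : RelatorAut g) (w : FreeGroup (surfaceGen g)) :
    A.toMulEquiv (PresentedGroup.mk _ w) = PresentedGroup.mk _ (A.hom w) :=
  A.toHom_mk w

/-- `toMulEquiv⁻¹` on the class of a word. [folklore] -/
@[simp] theorem toMulEquiv_symm_mk (A : RelatorAut g) (w : FreeGroup (surfaceGen g)) :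
    A.toMulEquiv.symm (PresentedGroup.mk _ w) = PresentedGroup.mk _ (A.inv w) :=
  A.invHom_mk w

/-- Identity. [folklore] -/
def refl : RelatorAut g := ⟨MonoidHom.id _, MonoidHom.id _, rfl, rfl, rfl, rfl⟩

/-- Composition (`A` first, then `B`). [folklore] -/
def trans (A B : RelatorAut g) : RelatorAut g where
  hom := B.hom.comp A.hom
  inv := A.inv.comp B.inv
  hom_rel := by rw [MonoidHom.comp_apply, A.hom_rel, B.hom_rel]
  inv_rel := by rw [MonoidHom.comp_apply, B.inv_rel, A.inv_rel]
  inv_comp := MonoidHom.ext fun x => by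
    have h1 := DFunLike.congr_fun B.inv_comp (A.hom x)
    have h2 := DFunLike.congr_fun A.inv_comp x
    simp only [MonoidHom.comp_apply, MonoidHom.id_apply] at h1 h2 ⊢
    rw [h1, h2]
  hom_comp := MonoidHom.ext fun x => by
    have h1 := DFunLike.congr_fun A.hom_comp (B.inv x)
    have h2 := DFunLike.congr_fun B.hom_comp x
    simp only [MonoidHom.comp_apply, MonoidHom.id_apply] at h1 h2 ⊢
    rw [h1, h2]

/-- `refl` acts trivially on subgroups. [folklore] -/
theorem map_toMulEquiv_refl (K : Subgroup (SurfaceGroup g)) :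
    K.map (refl : RelatorAut g).toMulEquiv.toMonoidHom = K := by
  have : (refl : RelatorAut g).toMulEquiv.toMonoidHom = MonoidHom.id _ :=
    MonoidHom.ext fun x => by
      obtain ⟨w, rfl⟩ := PresentedGroup.mk_surjective _ x
      rw [MulEquiv.coe_toMonoidHom, toMulEquiv_mk]; rfl
  rw [this, Subgroup.map_id]

/-- `trans` acts by composition on subgroups. [folklore] -/
theorem map_toMulEquiv_trans (A B : RelatorAut g) (K : Subgroup (SurfaceGroup g)) :
    K.map (A.trans B).toMulEquiv.toMonoidHom =
      (K.map A.toMulEquiv.toMonoidHom).map B.toMulEquiv.toMonoidHom := by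
  have : (A.trans B).toMulEquiv.toMonoidHom =
      B.toMulEquiv.toMonoidHom.comp A.toMulEquiv.toMonoidHom :=
    MonoidHom.ext fun x => by
      obtain ⟨w, rfl⟩ := PresentedGroup.mk_surjective _ x
      simp only [MulEquiv.coe_toMonoidHom, MonoidHom.comp_apply, toMulEquiv_mk]
      rfl
  rw [this, Subgroup.map_map]

/-- Block sum of relator-fixing automorphisms of genera `g` and `h`: a relator-fixing automorphism
of genus `g + h` (`r_{g+h} = ι r_g · σ r_h`). [folklore] -/
def blockSum (A : RelatorAut g) (B : RelatorAut h) : RelatorAut (g + h) where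
  hom := freeExtend ((genInclAdd g h).comp A.hom) ((genShiftAdd g h).comp B.hom)
  inv := freeExtend ((genInclAdd g h).comp A.inv) ((genShiftAdd g h).comp B.inv)
  hom_rel := by
    rw [surfaceRelator_add, map_mul, ← MonoidHom.comp_apply, freeExtend_comp_genInclAdd,
      ← MonoidHom.comp_apply (freeExtend _ _) (genShiftAdd g h), freeExtend_comp_genShiftAdd,
      MonoidHom.comp_apply, MonoidHom.comp_apply, A.hom_rel, B.hom_rel]
  inv_rel := by
    rw [surfaceRelator_add, map_mul, ← MonoidHom.comp_apply, freeExtend_comp_genInclAdd,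
      ← MonoidHom.comp_apply (freeExtend _ _) (genShiftAdd g h), freeExtend_comp_genShiftAdd,
      MonoidHom.comp_apply, MonoidHom.comp_apply, A.inv_rel, B.inv_rel]
  inv_comp := by
    refine freeGroup_hom_ext_add ?_ ?_
    · rw [MonoidHom.comp_assoc, freeExtend_comp_genInclAdd, ← MonoidHom.comp_assoc,
        freeExtend_comp_genInclAdd, MonoidHom.comp_assoc, A.inv_comp, MonoidHom.comp_id,
        MonoidHom.id_comp]
    · rw [MonoidHom.comp_assoc, freeExtend_comp_genShiftAdd, ← MonoidHom.comp_assoc,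
        freeExtend_comp_genShiftAdd, MonoidHom.comp_assoc, B.inv_comp, MonoidHom.comp_id,
        MonoidHom.id_comp]
  hom_comp := by
    refine freeGroup_hom_ext_add ?_ ?_
    · rw [MonoidHom.comp_assoc, freeExtend_comp_genInclAdd, ← MonoidHom.comp_assoc,
        freeExtend_comp_genInclAdd, MonoidHom.comp_assoc, A.hom_comp, MonoidHom.comp_id,
        MonoidHom.id_comp]
    · rw [MonoidHom.comp_assoc, freeExtend_comp_genShiftAdd, ← MonoidHom.comp_assoc,
        freeExtend_comp_genShiftAdd, MonoidHom.comp_assoc, B.hom_comp, MonoidHom.comp_id,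
        MonoidHom.id_comp]

/-- the block sum on the first block. [folklore] -/
theorem blockSum_hom_genInclAdd (A : RelatorAut g) (B : RelatorAut h) (w : FreeGroup (surfaceGen g)) :
    (A.blockSum B).hom (genInclAdd g h w) = genInclAdd g h (A.hom w) :=
  DFunLike.congr_fun (freeExtend_comp_genInclAdd ((genInclAdd g h).comp A.hom)
    ((genShiftAdd g h).comp B.hom)) w

/-- the block sum on the second block. [folklore] -/
theorem blockSum_hom_genShiftAdd (A : RelatorAut g) (B : RelatorAut h) (w : FreeGroup (surfaceGen h)) :
    (A.blockSum B).hom (genShiftAdd g h w) = genShiftAdd g h (B.hom w) :=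
  DFunLike.congr_fun (freeExtend_comp_genShiftAdd ((genInclAdd g h).comp A.hom)
    ((genShiftAdd g h).comp B.hom)) w

/-- A relator-fixing automorphism permutes full preimages of subgroups of `S_g`. [folklore] -/
theorem image_hom_preimage_mk (A : RelatorAut g) (K : Subgroup (SurfaceGroup g)) :
    A.hom '' ((PresentedGroup.mk _) ⁻¹' (K : Set (SurfaceGroup g))) =
      (PresentedGroup.mk _) ⁻¹'
        ((K.map A.toMulEquiv.toMonoidHom : Subgroup (SurfaceGroup g)) : Set (SurfaceGroup g)) := by
  ext v
  simp only [Set.mem_image, Set.mem_preimage, SetLike.mem_coe, Subgroup.mem_map,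
    MulEquiv.coe_toMonoidHom]
  constructor
  · rintro ⟨w, hw, rfl⟩
    exact ⟨PresentedGroup.mk _ w, hw, A.toMulEquiv_mk w⟩
  · rintro ⟨x, hx, hxv⟩
    refine ⟨A.inv v, ?_, DFunLike.congr_fun A.hom_comp v⟩
    have : PresentedGroup.mk _ (A.inv v) = x := by
      rw [← toMulEquiv_symm_mk, ← hxv, MulEquiv.symm_apply_apply]
    rw [this]
    exact hx

/-- the block sum on the first block (genus-3 second block). [folklore] -/
theorem blockSum_hom_genIncl (A : RelatorAut g) (B : RelatorAut 3) (w : FreeGroup (surfaceGen g)) :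
    (A.blockSum B).hom (genIncl g w) = genIncl g (A.hom w) :=
  blockSum_hom_genInclAdd A B w

/-- the block sum on the last three handles. [folklore] -/
theorem blockSum_hom_genShift (A : RelatorAut g) (B : RelatorAut 3) (w : FreeGroup (surfaceGen 3)) :
    (A.blockSum B).hom (genShift g w) = genShift g (B.hom w) :=
  blockSum_hom_genShiftAdd A B w

/-- ACTION ON STABILISATIONS: the block sum acts slot by slot on `K.stabilize`. [folklore] -/
theorem map_blockSum_stabilize (A : RelatorAut g) (B : RelatorAut 3) (K : TrisectionKernels g)
    (i : Fin 3) :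
    (K.stabilize i).map (A.blockSum B).toMulEquiv.toMonoidHom =
      normalClosure (stabSet
        (((K i).map A.toMulEquiv.toMonoidHom : Subgroup (SurfaceGroup g)) : Set (SurfaceGroup g))
        (((s4Kernels i).map B.toMulEquiv.toMonoidHom : Subgroup (SurfaceGroup 3)) :
          Set (SurfaceGroup 3))) := by
  rw [TrisectionKernels.stabilize_apply,
    Subgroup.map_normalClosure _ _ (by exact (A.blockSum B).toMulEquiv.surjective)]
  congr 1
  simp only [stabSet, Set.image_union, Set.image_image, ← image_hom_preimage_mk]
  congr 1
  · refine Set.image_congr' fun w => ?_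
    simp only [Function.comp_apply, MulEquiv.coe_toMonoidHom, toMulEquiv_mk]
    rw [blockSum_hom_genIncl]
  · refine Set.image_congr' fun w => ?_
    simp only [Function.comp_apply, MulEquiv.coe_toMonoidHom, toMulEquiv_mk]
    rw [blockSum_hom_genShift]

/-- Corollary: if `A` realises the slot permutation `π` on `K` and `B` realises it on the genus-3
standard triple, then `A ⊞ B` realises it on `K.stabilize`. [folklore] -/
theorem map_blockSum_stabilize_of_perm (A : RelatorAut g) (B : RelatorAut 3) (K : TrisectionKernels g)
    (π : Equiv.Perm (Fin 3)) (hA : ∀ i, (K i).map A.toMulEquiv.toMonoidHom = K (π i))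
    (hB : ∀ i, (s4Kernels i).map B.toMulEquiv.toMonoidHom = s4Kernels (π i)) (i : Fin 3) :
    (K.stabilize i).map (A.blockSum B).toMulEquiv.toMonoidHom = K.stabilize (π i) := by
  rw [map_blockSum_stabilize, hA, hB, TrisectionKernels.stabilize_apply]

/-! ### Genus 3: two relator-fixing generators of the slot symmetry -/

/-- Constructor from generator images (genus 3), all four identities checked in the free group.
[folklore] -/
def ofGens (f finv : surfaceGen 3 → FreeGroup (surfaceGen 3))
    (h1 : FreeGroup.lift f (surfaceRelator 3) = surfaceRelator 3)
    (h2 : FreeGroup.lift finv (surfaceRelator 3) = surfaceRelator 3)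
    (h3 : ∀ x, FreeGroup.lift finv (f x) = FreeGroup.of x)
    (h4 : ∀ x, FreeGroup.lift f (finv x) = FreeGroup.of x) : RelatorAut 3 where
  hom := FreeGroup.lift f
  inv := FreeGroup.lift finv
  hom_rel := h1
  inv_rel := h2
  inv_comp := FreeGroup.ext_hom _ _ fun x => by simp [h3]
  hom_comp := FreeGroup.ext_hom _ _ fun x => by simp [h4]

/-- `[a₀, b₀]` as a word. [folklore] -/
def comm0 : FreeGroup (surfaceGen 3) := genA 0 * genB 0 * (genA 0)⁻¹ * (genB 0)⁻¹
/-- `[a₁, b₁]` as a word. [folklore] -/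
def comm1 : FreeGroup (surfaceGen 3) := genA 1 * genB 1 * (genA 1)⁻¹ * (genB 1)⁻¹
/-- `[a₂, b₂]` as a word. [folklore] -/
def comm2 : FreeGroup (surfaceGen 3) := genA 2 * genB 2 * (genA 2)⁻¹ * (genB 2)⁻¹

/-- The relator-fixing CYCLIC HANDLE SHIFT `c : x_h ↦ [a₀,b₀] x_{h+1} [a₀,b₀]⁻¹` (the plain shift
sends `r` to `[a₀,b₀]⁻¹ r [a₀,b₀]`; the inner correction fixes `r` on the nose). [folklore] -/
def cycGen (x : surfaceGen 3) : FreeGroup (surfaceGen 3) :=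
  comm0 * FreeGroup.of (x.1 + 1, x.2) * comm0⁻¹

/-- Its inverse `x_h ↦ [a₂,b₂]⁻¹ x_{h+2} [a₂,b₂]`. [folklore] -/
def cycInvGen (x : surfaceGen 3) : FreeGroup (surfaceGen 3) :=
  comm2⁻¹ * FreeGroup.of (x.1 + 2, x.2) * comm2

/-- The cyclic handle shift as a relator-fixing automorphism. [folklore] -/
def cyc : RelatorAut 3 :=
  ofGens cycGen cycInvGen (by decide) (by decide) (by decide) (by decide)

/-- The relator-fixing ADJACENT HANDLE TRANSPOSITION `t` of handles `1, 2`: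
`a₁ ↦ [a₁,b₁] a₂ [a₁,b₁]⁻¹`, `b₁ ↦ [a₁,b₁] b₂ [a₁,b₁]⁻¹`, `a₂ ↦ a₁`, `b₂ ↦ b₁`, handle `0`
fixed (the naive letter swap does NOT fix `r`). [folklore] -/
def swapGen (x : surfaceGen 3) : FreeGroup (surfaceGen 3) :=
  if x.1 = 1 then comm1 * FreeGroup.of (2, x.2) * comm1⁻¹
  else if x.1 = 2 then FreeGroup.of (1, x.2)
  else FreeGroup.of x

/-- Its inverse: `a₁ ↦ a₂`, `b₁ ↦ b₂`, `a₂ ↦ [a₂,b₂]⁻¹ a₁ [a₂,b₂]`, `b₂ ↦ [a₂,b₂]⁻¹ b₁ [a₂,b₂]`.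
[folklore] -/
def swapInvGen (x : surfaceGen 3) : FreeGroup (surfaceGen 3) :=
  if x.1 = 1 then FreeGroup.of (2, x.2)
  else if x.1 = 2 then comm2⁻¹ * FreeGroup.of (1, x.2) * comm2
  else FreeGroup.of x

/-- The adjacent handle transposition as a relator-fixing automorphism. [folklore] -/
def swp : RelatorAut 3 :=
  ofGens swapGen swapInvGen (by decide) (by decide) (by decide) (by decide)

/-- Criterion for the image of a normal closure under an automorphism. [folklore] -/
theorem map_normalClosure_eq_of {G : Type*} [Group G] (σ : G ≃* G) (s t : Set G)
    (h1 : ∀ x ∈ s, σ x ∈ normalClosure t) (h2 : ∀ y ∈ t, σ.symm y ∈ normalClosure s) :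
    (normalClosure s).map σ.toMonoidHom = normalClosure t := by
  apply le_antisymm
  · rw [Subgroup.map_le_iff_le_comap]
    exact normalClosure_le_normal fun x hx => by simpa using h1 x hx
  · rw [Subgroup.map_equiv_eq_comap_symm']
    exact normalClosure_le_normal fun y hy => by simpa using h2 y hy

/-- `N₀ = ⟪a₀,a₁,b₂⟫`. [folklore] -/
theorem s4Kernels_zero : s4Kernels 0 =
    normalClosure {SurfaceGroup.a 0, SurfaceGroup.a 1, SurfaceGroup.b 2} := rfl
/-- `N₁ = ⟪a₀,b₁,a₂⟫`. [folklore] -/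
theorem s4Kernels_one : s4Kernels 1 =
    normalClosure {SurfaceGroup.a 0, SurfaceGroup.b 1, SurfaceGroup.a 2} := rfl
/-- `N₂ = ⟪b₀,a₁,a₂⟫`. [folklore] -/
theorem s4Kernels_two : s4Kernels 2 =
    normalClosure {SurfaceGroup.b 0, SurfaceGroup.a 1, SurfaceGroup.a 2} := rfl

/-- Conjugates of members of a normal closure are members. [folklore] -/
theorem conj_mem_nc {G : Type*} [Group G] {s : Set G} (c x : G) (hx : x ∈ normalClosure s) :
    c * x * c⁻¹ ∈ normalClosure s :=
  (normalClosure_normal (s := s)).conj_mem x hx c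

/-- inverse-conjugates of members of a normal closure are members. [folklore] -/
theorem conj_mem_nc' {G : Type*} [Group G] {s : Set G} (c x : G) (hx : x ∈ normalClosure s) :
    c⁻¹ * x * c ∈ normalClosure s := by
  simpa using (normalClosure_normal (s := s)).conj_mem x hx c⁻¹

/-- `cyc` on a generator. [folklore] -/
theorem cyc_of (x : surfaceGen 3) : cyc.toMulEquiv (PresentedGroup.of x) =
    PresentedGroup.mk _ comm0 * PresentedGroup.of (x.1 + 1, x.2) * (PresentedGroup.mk _ comm0)⁻¹ := by
  change cyc.toMulEquiv (PresentedGroup.mk _ (FreeGroup.of x)) = _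
  rw [toMulEquiv_mk]
  simp [cyc, ofGens, cycGen, PresentedGroup.of]

/-- `cyc⁻¹` on a generator. [folklore] -/
theorem cyc_symm_of (x : surfaceGen 3) : cyc.toMulEquiv.symm (PresentedGroup.of x) =
    (PresentedGroup.mk _ comm2)⁻¹ * PresentedGroup.of (x.1 + 2, x.2) * PresentedGroup.mk _ comm2 := by
  change cyc.toMulEquiv.symm (PresentedGroup.mk _ (FreeGroup.of x)) = _
  rw [toMulEquiv_symm_mk]
  simp [cyc, ofGens, cycInvGen, PresentedGroup.of]

/-- `swp` on a generator. [folklore] -/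
theorem swp_of (x : surfaceGen 3) : swp.toMulEquiv (PresentedGroup.of x) =
    PresentedGroup.mk _ (swapGen x) := by
  change swp.toMulEquiv (PresentedGroup.mk _ (FreeGroup.of x)) = _
  rw [toMulEquiv_mk]
  simp [swp, ofGens]

/-- `swp⁻¹` on a generator. [folklore] -/
theorem swp_symm_of (x : surfaceGen 3) : swp.toMulEquiv.symm (PresentedGroup.of x) =
    PresentedGroup.mk _ (swapInvGen x) := by
  change swp.toMulEquiv.symm (PresentedGroup.mk _ (FreeGroup.of x)) = _
  rw [toMulEquiv_symm_mk]
  simp [swp, ofGens]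

/-- The slot permutation of `cyc`: `0 ↦ 2 ↦ 1 ↦ 0`. [folklore] -/
def cycPerm : Equiv.Perm (Fin 3) := Equiv.swap 1 2 * Equiv.swap 0 1

/-- values of `cycPerm`. [folklore] -/
theorem cycPerm_apply : cycPerm 0 = 2 ∧ cycPerm 1 = 0 ∧ cycPerm 2 = 1 := by decide

/-- The slot permutation of `swp`: `0 ↔ 1`. [folklore] -/
def swpPerm : Equiv.Perm (Fin 3) := Equiv.swap 0 1


/-! ### Fin 3 arithmetic helpers -/
/-- `0 + 1 = 1` in `Fin 3`. [folklore] -/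
theorem fin3_zero_add_one : (0 : Fin 3) + 1 = 1 := by decide
/-- `2 + 1 = 0` in `Fin 3`. [folklore] -/
theorem fin3_two_add_one : (2 : Fin 3) + 1 = 0 := by decide
/-- `1 + 1 = 2` in `Fin 3`. [folklore] -/
theorem fin3_one_add_one : (1 : Fin 3) + 1 = 2 := by decide
/-- `1 + 2 = 0` in `Fin 3`. [folklore] -/
theorem fin3_one_add_two : (1 : Fin 3) + 2 = 0 := by decide
/-- `2 + 2 = 1` in `Fin 3`. [folklore] -/
theorem fin3_two_add_two : (2 : Fin 3) + 2 = 1 := by decide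
/-- `0 + 2 = 2` in `Fin 3`. [folklore] -/
theorem fin3_zero_add_two : (0 : Fin 3) + 2 = 2 := by decide

/-- `C0 = [a₀,b₀]` in `S_3`. [folklore] -/
def C0 : SurfaceGroup 3 := PresentedGroup.mk _ comm0
/-- `C1 = [a₁,b₁]` in `S_3`. [folklore] -/
def C1 : SurfaceGroup 3 := PresentedGroup.mk _ comm1
/-- `C2 = [a₂,b₂]` in `S_3`. [folklore] -/
def C2 : SurfaceGroup 3 := PresentedGroup.mk _ comm2

/-- `cyc aᵢ = C0 a_{i+1} C0⁻¹`. [folklore] -/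
theorem cyc_a (i : Fin 3) : cyc.toMulEquiv (SurfaceGroup.a i) = C0 * SurfaceGroup.a (i + 1) * C0⁻¹ :=
  cyc_of (i, false)
/-- `cyc bᵢ = C0 b_{i+1} C0⁻¹`. [folklore] -/
theorem cyc_b (i : Fin 3) : cyc.toMulEquiv (SurfaceGroup.b i) = C0 * SurfaceGroup.b (i + 1) * C0⁻¹ :=
  cyc_of (i, true)
/-- `cyc⁻¹ aᵢ = C2⁻¹ a_{i+2} C2`. [folklore] -/
theorem cyc_symm_a (i : Fin 3) :
    cyc.toMulEquiv.symm (SurfaceGroup.a i) = C2⁻¹ * SurfaceGroup.a (i + 2) * C2 :=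
  cyc_symm_of (i, false)
/-- `cyc⁻¹ bᵢ = C2⁻¹ b_{i+2} C2`. [folklore] -/
theorem cyc_symm_b (i : Fin 3) :
    cyc.toMulEquiv.symm (SurfaceGroup.b i) = C2⁻¹ * SurfaceGroup.b (i + 2) * C2 :=
  cyc_symm_of (i, true)

/-- `swp a₀ = a₀`. [folklore] -/
theorem swp_a0 : swp.toMulEquiv (SurfaceGroup.a 0) = SurfaceGroup.a 0 := by
  rw [SurfaceGroup.a, swp_of]; simp [swapGen, PresentedGroup.of]
/-- `swp b₀ = b₀`. [folklore] -/
theorem swp_b0 : swp.toMulEquiv (SurfaceGroup.b 0) = SurfaceGroup.b 0 := by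
  rw [SurfaceGroup.b, swp_of]; simp [swapGen, PresentedGroup.of]
/-- `swp a₁ = C1 a₂ C1⁻¹`. [folklore] -/
theorem swp_a1 : swp.toMulEquiv (SurfaceGroup.a 1) = C1 * SurfaceGroup.a 2 * C1⁻¹ := by
  rw [SurfaceGroup.a, swp_of]; simp [swapGen, PresentedGroup.of, SurfaceGroup.a, C1]
/-- `swp b₁ = C1 b₂ C1⁻¹`. [folklore] -/
theorem swp_b1 : swp.toMulEquiv (SurfaceGroup.b 1) = C1 * SurfaceGroup.b 2 * C1⁻¹ := by
  rw [SurfaceGroup.b, swp_of]; simp [swapGen, PresentedGroup.of, SurfaceGroup.b, C1]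
/-- `swp a₂ = a₁`. [folklore] -/
theorem swp_a2 : swp.toMulEquiv (SurfaceGroup.a 2) = SurfaceGroup.a 1 := by
  rw [SurfaceGroup.a, swp_of]; simp [swapGen, PresentedGroup.of, SurfaceGroup.a]
/-- `swp b₂ = b₁`. [folklore] -/
theorem swp_b2 : swp.toMulEquiv (SurfaceGroup.b 2) = SurfaceGroup.b 1 := by
  rw [SurfaceGroup.b, swp_of]; simp [swapGen, PresentedGroup.of, SurfaceGroup.b]
/-- `swp⁻¹ a₀ = a₀`. [folklore] -/
theorem swp_symm_a0 : swp.toMulEquiv.symm (SurfaceGroup.a 0) = SurfaceGroup.a 0 := by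
  rw [SurfaceGroup.a, swp_symm_of]; simp [swapInvGen, PresentedGroup.of]
/-- `swp⁻¹ b₀ = b₀`. [folklore] -/
theorem swp_symm_b0 : swp.toMulEquiv.symm (SurfaceGroup.b 0) = SurfaceGroup.b 0 := by
  rw [SurfaceGroup.b, swp_symm_of]; simp [swapInvGen, PresentedGroup.of]
/-- `swp⁻¹ a₁ = a₂`. [folklore] -/
theorem swp_symm_a1 : swp.toMulEquiv.symm (SurfaceGroup.a 1) = SurfaceGroup.a 2 := by
  rw [SurfaceGroup.a, swp_symm_of]; simp [swapInvGen, PresentedGroup.of, SurfaceGroup.a]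
/-- `swp⁻¹ b₁ = b₂`. [folklore] -/
theorem swp_symm_b1 : swp.toMulEquiv.symm (SurfaceGroup.b 1) = SurfaceGroup.b 2 := by
  rw [SurfaceGroup.b, swp_symm_of]; simp [swapInvGen, PresentedGroup.of, SurfaceGroup.b]
/-- `swp⁻¹ a₂ = C2⁻¹ a₁ C2`. [folklore] -/
theorem swp_symm_a2 : swp.toMulEquiv.symm (SurfaceGroup.a 2) = C2⁻¹ * SurfaceGroup.a 1 * C2 := by
  rw [SurfaceGroup.a, swp_symm_of]; simp [swapInvGen, PresentedGroup.of, SurfaceGroup.a, C2]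
/-- `swp⁻¹ b₂ = C2⁻¹ b₁ C2`. [folklore] -/
theorem swp_symm_b2 : swp.toMulEquiv.symm (SurfaceGroup.b 2) = C2⁻¹ * SurfaceGroup.b 1 * C2 := by
  rw [SurfaceGroup.b, swp_symm_of]; simp [swapInvGen, PresentedGroup.of, SurfaceGroup.b, C2]

/-! ### Slot actions at genus 3 -/

/-- `cyc N₀ = N₂`. [folklore] -/
theorem map_cyc_zero : (s4Kernels 0).map cyc.toMulEquiv.toMonoidHom = s4Kernels 2 := by
  rw [s4Kernels_zero, s4Kernels_two]
  refine map_normalClosure_eq_of _ _ _ ?_ ?_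
  · intro x hx
    simp only [Set.mem_insert_iff, Set.mem_singleton_iff] at hx
    rcases hx with rfl | rfl | rfl
    · rw [cyc_a, fin3_zero_add_one]; exact conj_mem_nc _ _ (subset_normalClosure (by simp))
    · rw [cyc_a, fin3_one_add_one]; exact conj_mem_nc _ _ (subset_normalClosure (by simp))
    · rw [cyc_b, fin3_two_add_one]; exact conj_mem_nc _ _ (subset_normalClosure (by simp))
  · intro y hy
    simp only [Set.mem_insert_iff, Set.mem_singleton_iff] at hy
    rcases hy with rfl | rfl | rfl
    · rw [cyc_symm_b, fin3_zero_add_two]; exact conj_mem_nc' _ _ (subset_normalClosure (by simp))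
    · rw [cyc_symm_a, fin3_one_add_two]; exact conj_mem_nc' _ _ (subset_normalClosure (by simp))
    · rw [cyc_symm_a, fin3_two_add_two]; exact conj_mem_nc' _ _ (subset_normalClosure (by simp))

/-- `cyc N₁ = N₀`. [folklore] -/
theorem map_cyc_one : (s4Kernels 1).map cyc.toMulEquiv.toMonoidHom = s4Kernels 0 := by
  rw [s4Kernels_one, s4Kernels_zero]
  refine map_normalClosure_eq_of _ _ _ ?_ ?_
  · intro x hx
    simp only [Set.mem_insert_iff, Set.mem_singleton_iff] at hx
    rcases hx with rfl | rfl | rfl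
    · rw [cyc_a, fin3_zero_add_one]; exact conj_mem_nc _ _ (subset_normalClosure (by simp))
    · rw [cyc_b, fin3_one_add_one]; exact conj_mem_nc _ _ (subset_normalClosure (by simp))
    · rw [cyc_a, fin3_two_add_one]; exact conj_mem_nc _ _ (subset_normalClosure (by simp))
  · intro y hy
    simp only [Set.mem_insert_iff, Set.mem_singleton_iff] at hy
    rcases hy with rfl | rfl | rfl
    · rw [cyc_symm_a, fin3_zero_add_two]; exact conj_mem_nc' _ _ (subset_normalClosure (by simp))
    · rw [cyc_symm_a, fin3_one_add_two]; exact conj_mem_nc' _ _ (subset_normalClosure (by simp))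
    · rw [cyc_symm_b, fin3_two_add_two]; exact conj_mem_nc' _ _ (subset_normalClosure (by simp))

/-- `cyc N₂ = N₁`. [folklore] -/
theorem map_cyc_two : (s4Kernels 2).map cyc.toMulEquiv.toMonoidHom = s4Kernels 1 := by
  rw [s4Kernels_two, s4Kernels_one]
  refine map_normalClosure_eq_of _ _ _ ?_ ?_
  · intro x hx
    simp only [Set.mem_insert_iff, Set.mem_singleton_iff] at hx
    rcases hx with rfl | rfl | rfl
    · rw [cyc_b, fin3_zero_add_one]; exact conj_mem_nc _ _ (subset_normalClosure (by simp))
    · rw [cyc_a, fin3_one_add_one]; exact conj_mem_nc _ _ (subset_normalClosure (by simp))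
    · rw [cyc_a, fin3_two_add_one]; exact conj_mem_nc _ _ (subset_normalClosure (by simp))
  · intro y hy
    simp only [Set.mem_insert_iff, Set.mem_singleton_iff] at hy
    rcases hy with rfl | rfl | rfl
    · rw [cyc_symm_a, fin3_zero_add_two]; exact conj_mem_nc' _ _ (subset_normalClosure (by simp))
    · rw [cyc_symm_b, fin3_one_add_two]; exact conj_mem_nc' _ _ (subset_normalClosure (by simp))
    · rw [cyc_symm_a, fin3_two_add_two]; exact conj_mem_nc' _ _ (subset_normalClosure (by simp))

/-- `swp N₀ = N₁`. [folklore] -/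
theorem map_swp_zero : (s4Kernels 0).map swp.toMulEquiv.toMonoidHom = s4Kernels 1 := by
  rw [s4Kernels_zero, s4Kernels_one]
  refine map_normalClosure_eq_of _ _ _ ?_ ?_
  · intro x hx
    simp only [Set.mem_insert_iff, Set.mem_singleton_iff] at hx
    rcases hx with rfl | rfl | rfl
    · rw [swp_a0]; exact subset_normalClosure (by simp)
    · rw [swp_a1]; exact conj_mem_nc _ _ (subset_normalClosure (by simp))
    · rw [swp_b2]; exact subset_normalClosure (by simp)
  · intro y hy
    simp only [Set.mem_insert_iff, Set.mem_singleton_iff] at hy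
    rcases hy with rfl | rfl | rfl
    · rw [swp_symm_a0]; exact subset_normalClosure (by simp)
    · rw [swp_symm_b1]; exact subset_normalClosure (by simp)
    · rw [swp_symm_a2]; exact conj_mem_nc' _ _ (subset_normalClosure (by simp))

/-- `swp N₁ = N₀`. [folklore] -/
theorem map_swp_one : (s4Kernels 1).map swp.toMulEquiv.toMonoidHom = s4Kernels 0 := by
  rw [s4Kernels_one, s4Kernels_zero]
  refine map_normalClosure_eq_of _ _ _ ?_ ?_
  · intro x hx
    simp only [Set.mem_insert_iff, Set.mem_singleton_iff] at hx
    rcases hx with rfl | rfl | rfl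
    · rw [swp_a0]; exact subset_normalClosure (by simp)
    · rw [swp_b1]; exact conj_mem_nc _ _ (subset_normalClosure (by simp))
    · rw [swp_a2]; exact subset_normalClosure (by simp)
  · intro y hy
    simp only [Set.mem_insert_iff, Set.mem_singleton_iff] at hy
    rcases hy with rfl | rfl | rfl
    · rw [swp_symm_a0]; exact subset_normalClosure (by simp)
    · rw [swp_symm_a1]; exact subset_normalClosure (by simp)
    · rw [swp_symm_b2]; exact conj_mem_nc' _ _ (subset_normalClosure (by simp))

/-- `swp N₂ = N₂`. [folklore] -/
theorem map_swp_two : (s4Kernels 2).map swp.toMulEquiv.toMonoidHom = s4Kernels 2 := by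
  rw [s4Kernels_two]
  refine map_normalClosure_eq_of _ _ _ ?_ ?_
  · intro x hx
    simp only [Set.mem_insert_iff, Set.mem_singleton_iff] at hx
    rcases hx with rfl | rfl | rfl
    · rw [swp_b0]; exact subset_normalClosure (by simp)
    · rw [swp_a1]; exact conj_mem_nc _ _ (subset_normalClosure (by simp))
    · rw [swp_a2]; exact subset_normalClosure (by simp)
  · intro y hy
    simp only [Set.mem_insert_iff, Set.mem_singleton_iff] at hy
    rcases hy with rfl | rfl | rfl
    · rw [swp_symm_b0]; exact subset_normalClosure (by simp)
    · rw [swp_symm_a1]; exact subset_normalClosure (by simp)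
    · rw [swp_symm_a2]; exact conj_mem_nc' _ _ (subset_normalClosure (by simp))

/-- `cyc` realises the slot permutation `cycPerm`. [folklore] -/
theorem map_cyc_s4Kernels (i : Fin 3) :
    (s4Kernels i).map cyc.toMulEquiv.toMonoidHom = s4Kernels (cycPerm i) := by
  fin_cases i
  · exact map_cyc_zero.trans (congrArg s4Kernels (by decide))
  · exact map_cyc_one.trans (congrArg s4Kernels (by decide))
  · exact map_cyc_two.trans (congrArg s4Kernels (by decide))

/-- `swp` realises the slot permutation `swpPerm`. [folklore] -/
theorem map_swp_s4Kernels (i : Fin 3) :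
    (s4Kernels i).map swp.toMulEquiv.toMonoidHom = s4Kernels (swpPerm i) := by
  fin_cases i
  · exact map_swp_zero.trans (congrArg s4Kernels (by decide))
  · exact map_swp_one.trans (congrArg s4Kernels (by decide))
  · exact map_swp_two.trans (congrArg s4Kernels (by decide))

/-- Realisers compose. [folklore] -/
theorem realises_trans {g' : ℕ} {K : TrisectionKernels g'} {A B : RelatorAut g'}
    {π₁ π₂ : Equiv.Perm (Fin 3)}
    (hA : ∀ i, (K i).map A.toMulEquiv.toMonoidHom = K (π₁ i))
    (hB : ∀ i, (K i).map B.toMulEquiv.toMonoidHom = K (π₂ i)) (i : Fin 3) :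
    (K i).map (A.trans B).toMulEquiv.toMonoidHom = K ((π₂ * π₁) i) := by
  rw [map_toMulEquiv_trans, hA, hB, Equiv.Perm.mul_apply]

/-- Every slot permutation of the genus-3 standard triple is realised by a relator-fixing
automorphism (`cyc`, `swp` generate `S₃`). [folklore] -/
theorem exists_relatorAut_three (π : Equiv.Perm (Fin 3)) :
    ∃ B : RelatorAut 3, ∀ i, (s4Kernels i).map B.toMulEquiv.toMonoidHom = s4Kernels (π i) := by
  have key : ∀ π : Equiv.Perm (Fin 3), π = 1 ∨ π = cycPerm ∨ π = cycPerm * cycPerm ∨ π = swpPerm ∨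
      π = swpPerm * cycPerm ∨ π = swpPerm * cycPerm * cycPerm := by
    decide
  rcases key π with rfl | rfl | rfl | rfl | rfl | rfl
  · exact ⟨refl, fun i => by rw [map_toMulEquiv_refl]; rfl⟩
  · exact ⟨cyc, map_cyc_s4Kernels⟩
  · exact ⟨cyc.trans cyc, realises_trans map_cyc_s4Kernels map_cyc_s4Kernels⟩
  · exact ⟨swp, map_swp_s4Kernels⟩
  · exact ⟨cyc.trans swp, realises_trans map_cyc_s4Kernels map_swp_s4Kernels⟩
  · refine ⟨cyc.trans (cyc.trans swp), fun i => ?_⟩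
    rw [realises_trans map_cyc_s4Kernels (realises_trans map_cyc_s4Kernels map_swp_s4Kernels) i,
      mul_assoc]

/-- INDUCTION OVER STABILISATIONS: a genus-3 realiser of `π` propagates to every `stabilizeIter m`
by block sums. [folklore] -/
theorem exists_relatorAut_stabilizeIter {π : Equiv.Perm (Fin 3)} (B : RelatorAut 3)
    (hB : ∀ i, (s4Kernels i).map B.toMulEquiv.toMonoidHom = s4Kernels (π i)) :
    ∀ m : ℕ, ∃ A : RelatorAut (3 + 3 * m),
      ∀ i, (s4Kernels.stabilizeIter m i).map A.toMulEquiv.toMonoidHom = s4Kernels.stabilizeIter m (π i)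
  | 0 => ⟨B, hB⟩
  | m + 1 => by
    obtain ⟨A, hA⟩ := exists_relatorAut_stabilizeIter B hB m
    exact ⟨A.blockSum B, fun i => map_blockSum_stabilize_of_perm A B _ π hA hB i⟩

end RelatorAut

open RelatorAut in
/-- **SLOT SYMMETRY OF THE STANDARD TRISECTION OF `S⁴` AT EVERY GENUS.**  For every `m` and every
permutation `π` of the three slots there is an automorphism `σ` of `S_{3+3m}` with
`σ(N_i) = N_{π i}` for all `i` (`N = s4Kernels.stabilizeIter m`).  In particular the three
kernels, the three ordered pairs and their reversals are indistinguishable up to `Aut S_g`.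
[folklore] -/
theorem stabilizeIter_slotSymmetric (m : ℕ) (π : Equiv.Perm (Fin 3)) :
    ∃ σ : SurfaceGroup (3 + 3 * m) ≃* SurfaceGroup (3 + 3 * m),
      ∀ i, (s4Kernels.stabilizeIter m i).map σ.toMonoidHom = s4Kernels.stabilizeIter m (π i) := by
  obtain ⟨B, hB⟩ := exists_relatorAut_three π
  obtain ⟨A, hA⟩ := exists_relatorAut_stabilizeIter B hB m
  exact ⟨A.toMulEquiv, hA⟩

/-- ORDERED = UNORDERED at every genus: the standard pair `(N_i, N_j)` admits a side swap in
`Aut S_{3+3m}` (generalises §B'' `exists_swap_s4Kernels`, `m = 0`, `(i,j) = (0,1)`). [folklore] -/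
theorem exists_swap_stabilizeIter (m : ℕ) (i j : Fin 3) :
    ∃ σ : SurfaceGroup (3 + 3 * m) ≃* SurfaceGroup (3 + 3 * m),
      (s4Kernels.stabilizeIter m i).map σ.toMonoidHom = s4Kernels.stabilizeIter m j ∧
      (s4Kernels.stabilizeIter m j).map σ.toMonoidHom = s4Kernels.stabilizeIter m i := by
  obtain ⟨σ, hσ⟩ := stabilizeIter_slotSymmetric m (Equiv.swap i j)
  exact ⟨σ, by rw [hσ, Equiv.swap_apply_left], by rw [hσ, Equiv.swap_apply_right]⟩

/-- All ordered standard pairs are `Aut`-equivalent to `(N₀, N₁)`. [folklore] -/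
theorem exists_aut_pair_stabilizeIter (m : ℕ) (i j : Fin 3) (hij : i ≠ j) :
    ∃ σ : SurfaceGroup (3 + 3 * m) ≃* SurfaceGroup (3 + 3 * m),
      (s4Kernels.stabilizeIter m 0).map σ.toMonoidHom = s4Kernels.stabilizeIter m i ∧
      (s4Kernels.stabilizeIter m 1).map σ.toMonoidHom = s4Kernels.stabilizeIter m j := by
  have key : ∀ i j : Fin 3, i ≠ j → ∃ π : Equiv.Perm (Fin 3), π 0 = i ∧ π 1 = j := by decide
  obtain ⟨π, h0, h1⟩ := key i j hij
  obtain ⟨σ, hσ⟩ := stabilizeIter_slotSymmetric m π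
  exact ⟨σ, by rw [hσ, h0], by rw [hσ, h1]⟩

/-- Slot permutation invariance of the trisection property. [folklore] -/
theorem IsGroupTrisection.comp_perm {g k : ℕ} {G : Type*} [Group G] {K : TrisectionKernels g}
    (hK : IsGroupTrisection g k G K) (π : Equiv.Perm (Fin 3)) :
    IsGroupTrisection g k G (fun i => K (π i)) := by
  refine ⟨fun i => hK.normal (π i), fun i => hK.free_quotient (π i),
    fun i j hij => hK.free_pairQuotient (π i) (π j) (fun h => hij (π.injective h)), ?_⟩
  obtain ⟨e⟩ := hK.triple
  refine ⟨(QuotientGroup.quotientMulEquivOfEq ?_).trans e⟩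
  change normalClosure (⋃ i, ((K (π i) : Subgroup (SurfaceGroup g)) : Set (SurfaceGroup g))) =
    normalClosure (⋃ i, ((K i : Subgroup (SurfaceGroup g)) : Set (SurfaceGroup g)))
  rw [π.surjective.iUnion_comp (fun i => ((K i : Subgroup (SurfaceGroup g)) : Set (SurfaceGroup g)))]

end Literature.Topology.FourManifolds
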